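import Summits.ValiantsHypothesis.ValiantsHypothesis.Theorems.LacunarySymmetroidMatrixDescartesDoorA26WallBubblingBubblingInertiaClosed
import Summits.ValiantsHypothesis.ValiantsHypothesis.Theorems.LacunarySymmetroidMatrixDescartesDoorA26WallBubblingLexRows
import Literature.Computability.AlgebraicComplexity.DeterminantalIdeal

/-!
# Wall bubbling for `DoorA26` — soundness of the MINOR rows (P4 / X4 / `--x4i` / `--allminors`, sizes 4, 5, 6): every `r × r` minor, `r ≥ 4`, of a
realisable would-be Gram matrix vanishes

LINE / STUBS.  Crux `Theses.LacunarySymmetroid.DoorA26` (stmt-ValiantsHypothesis-19979; OPEN, typed, never asserted), line `Cruxes/DoorA26/Lines/wall_bubbling.lean`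
(val-idea-15), obligation (M) `Stmt.stub_mixedWalls`.  The (M) instrument's row families beyond SSR/PM3 (memo `Lines/wall_bubbling_M-sieve.md` rev 10 §2.9 pilot
P4, §7.3 R1 `--allminors`, §7.6 X4 / `--x4i`; the R3 witness probe uses all 142 minors of sizes 4, 5, 6) are the `r × r` MINORS, `r ≥ 4`, of the letter Gram
`G = (J(u_a, u_b))_{a,b<6}`: as polynomial rows `f = det X[ρ, γ] = Σ_σ sgn σ · ∏_a X_{ρ(σa), γ(a)}` they VANISH on every realisable `G` (rank ≤ 3), and the
engine imposes their one-scale balance (top class ≥ 2 monomials, both signs) and — after R3 — their lexicographic balance (W1 #20 `…WallBubblingLexRows`, LEMMA L).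
crit-5 (2026-08-28T20:22Z): a kill is CERTIFIED only if each row used is matched to a kernel row literally.  This file is the kernel identity behind every
minor row (def-free; PM3's sign row is W1 #17 `…PrincipalMinors`, the balance rows are #20):

* `vecMulVec_three_eq_mul` — the rank-3 shape `v vᵀ − u uᵀ − w wᵀ = P · Q` through `ℝ³` (explicit `P : n × 3`, `Q : 3 × n`);
* `det_submatrix_of_isSymGram` — every `r × r` minor (`3 < r`; rows/columns `ρ γ : Fin r → n`, repetitions allowed, principal or not) of an `IsSymGram`
  matrix is `0` (via `Literature…det_submatrix_mul_eq_zero`); `det_submatrix_neg_of_isSymGram_neg` — the same for `−G`;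
* `realisable_det_submatrix` — **every `r × r` minor, `r ≥ 4`, of a `Realisable` `G` vanishes** (the chain's `realisable_iff`: `G` or `−G` is a shape);
* `realisable_minor_row` — the same in the engine's MONOMIAL currency: `Σ_{σ ∈ Perm(Fin r)} sgn σ · ∏_a G (ρ (σ a)) (γ a) = 0`;
* `realisable_minor_row_split` — split at a monomial class `T`: `Σ_{σ∈T} sgnσ·G^{σ} + Σ_{σ∉T} sgnσ·G^{σ} = 0`, i.e. the `(x, r)` data (`Σ_{i:T} x_i + r = 0`) that
  `lexRow_two` / `lexRow_topClass` / `lexRow_card_top` of #20 consume, for every realisable sequence `G^ν` and every minor (`realisable_minor_lexRow_data`);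
* `realisable_minor_lexRow_topClass`, `realisable_minor_lexRow_card`, `realisable_minor_lexRow_two` — the COMPOSED minor rows (one scale and lexicographic): a realisable
  sequence, a minor, a class `T` whose signed monomial values `x^ν` do not vanish identically and DOMINATE the rest ⇒ `|T| ≥ 2`, and along a subsequence two classes
  `σ ≠ τ ∈ T` of opposite eventual sign and relative fine height `0` at every finer scale; for `T = {σ₁, σ₂}` opposite signs eventually and `log|x| − log|y| → 0` along the
  whole sequence (#20 applied to the data above; the `x`, `rest` of the certificate enter through defining hypotheses `hxdef`, `hrdef`).

A necessary condition only (it licenses the minor rows; it kills nothing); nothing here bears on (M)/(W)/(R), on `DoorA26`, on `MatrixDescartes`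
(stmt-ValiantsHypothesis-18050) or on `VP ≠ VNP`; registers unchanged.  Seat val-sym-door-p2 g12 (W1 #21), `--supports stmt-ValiantsHypothesis-19979 --as helper`.
[folklore] rank ≤ 3 ⇒ minors of size ≥ 4 vanish. [this work] packaging in the instrument's currency.
-/

-- `Summit.ValiantsHypothesis.ValiantsHypothesis.…` repeats a component by the D-0017 layout
-- (single-conjunct summit), which the `dupNamespace` linter flags; the name is mandated.
set_option linter.dupNamespace false

namespace Summit.ValiantsHypothesis.ValiantsHypothesis.Theorems.LacunarySymmetroidMatrixDescartes.WallBubbling.SecondOrder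

open Matrix Finset
open scoped BigOperators
open Summit.ValiantsHypothesis.ValiantsHypothesis.Theorems.LacunarySymmetroidMatrixDescartes.WallBubbling.Bubbling

section Shape

variable {n : Type*}

/-- The rank-3 shape factors through `ℝ³`: `v vᵀ − u uᵀ − w wᵀ = P · Q` with `P a = (v_a, −u_a, −w_a)` and `Q · b = (v_b, u_b, w_b)`. [folklore] -/
theorem vecMulVec_three_eq_mul (v u w : n → ℝ) :
    vecMulVec v v - vecMulVec u u - vecMulVec w w =
      (Matrix.of fun a (s : Fin 3) => ![v a, -u a, -w a] s) * (Matrix.of fun (s : Fin 3) b => ![v b, u b, w b] s) := by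
  ext a b
  simp only [Matrix.sub_apply, Matrix.vecMulVec_apply, Matrix.mul_apply, Matrix.of_apply, Fin.sum_univ_three,
    Matrix.cons_val_zero, Matrix.cons_val_one, Matrix.cons_val_two, Matrix.head_cons, Matrix.tail_cons]
  ring

/-- **Every `r × r` minor (`r ≥ 4`) of a rank-3 shape vanishes** — rows `ρ` and columns `γ` arbitrary (`Fin r → n`, repetitions allowed). [folklore] -/
theorem det_submatrix_of_isSymGram {M : Matrix n n ℝ} (hM : IsSymGram M) {r : ℕ} (hr : 3 < r)
    (ρ γ : Fin r → n) : (M.submatrix ρ γ).det = 0 := by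
  obtain ⟨v, u, w, h⟩ := hM
  rw [h, vecMulVec_three_eq_mul]
  exact Literature.Computability.AlgebraicComplexity.det_submatrix_mul_eq_zero (by simpa using hr) _ _ ρ γ

/-- The same when `−M` is a shape. [folklore] -/
theorem det_submatrix_of_isSymGram_neg {M : Matrix n n ℝ} (hM : IsSymGram (-M)) {r : ℕ} (hr : 3 < r)
    (ρ γ : Fin r → n) : (M.submatrix ρ γ).det = 0 := by
  have h := det_submatrix_of_isSymGram hM hr ρ γ
  have e : (-M).submatrix ρ γ = -(M.submatrix ρ γ) := by
    ext a b
    rfl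
  rw [e, Matrix.det_neg] at h
  rcases mul_eq_zero.mp h with h0 | h0
  · exact absurd h0 (pow_ne_zero _ (by norm_num))
  · exact h0

end Shape

/-- **MINOR ROWS ARE SOUND: every `r × r` minor, `r ≥ 4`, of a realisable would-be Gram matrix vanishes** (all `4 × 4`, `5 × 5`, `6 × 6` minors, principal or not;
rows/columns `ρ γ : Fin r → Fin 6`). [folklore] -/
theorem realisable_det_submatrix {G : Matrix (Fin 6) (Fin 6) ℝ} (hG : Realisable G) {r : ℕ} (hr : 3 < r)
    (ρ γ : Fin r → Fin 6) : (G.submatrix ρ γ).det = 0 := by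
  rcases (realisable_iff G).mp hG with h | h
  · exact det_submatrix_of_isSymGram h hr ρ γ
  · exact det_submatrix_of_isSymGram_neg h hr ρ γ

/-- **The minor row in MONOMIAL currency**: `Σ_{σ ∈ Perm(Fin r)} sgn σ · ∏_a G (ρ (σ a)) (γ a) = 0` for realisable `G`, `r ≥ 4`. [folklore] -/
theorem realisable_minor_row {G : Matrix (Fin 6) (Fin 6) ℝ} (hG : Realisable G) {r : ℕ} (hr : 3 < r)
    (ρ γ : Fin r → Fin 6) :
    ∑ σ : Equiv.Perm (Fin r), ((Equiv.Perm.sign σ : ℤ) : ℝ) * ∏ a, G (ρ (σ a)) (γ a) = 0 := by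
  have h := realisable_det_submatrix hG hr ρ γ
  rw [Matrix.det_apply'] at h
  simpa [Matrix.submatrix_apply] using h

/-- **The `(x, r)` data of a minor row at a monomial class `T`** (the input of #20's `lexRow_*`): for realisable `G`, `r ≥ 4` and any set `T` of permutations,
`Σ_{σ : T} sgn σ · G^{σ} + Σ_{σ ∉ T} sgn σ · G^{σ} = 0`. [this work] -/
theorem realisable_minor_row_split {G : Matrix (Fin 6) (Fin 6) ℝ} (hG : Realisable G) {r : ℕ} (hr : 3 < r)
    (ρ γ : Fin r → Fin 6) (T : Finset (Equiv.Perm (Fin r))) :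
    ∑ σ : T, ((Equiv.Perm.sign (σ : Equiv.Perm (Fin r)) : ℤ) : ℝ) * ∏ a, G (ρ ((σ : Equiv.Perm (Fin r)) a)) (γ a) +
      ∑ σ ∈ Tᶜ, ((Equiv.Perm.sign σ : ℤ) : ℝ) * ∏ a, G (ρ (σ a)) (γ a) = 0 := by
  rw [Finset.sum_coe_sort T (fun σ => ((Equiv.Perm.sign σ : ℤ) : ℝ) * ∏ a, G (ρ (σ a)) (γ a)),
    Finset.sum_add_sum_compl]
  exact realisable_minor_row hG hr ρ γ

/-- **Sequence form** (what the engine's lexicographic minor rows consume): along a realisable sequence `G^ν`, for every minor and monomial class `T`, the top values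
`x^ν_σ := sgn σ · G^{ν,σ}` (`σ ∈ T`) and the rest `r^ν` satisfy the ROW `Σ_{σ:T} x^ν_σ + r^ν = 0` of `lexRow_two` / `lexRow_topClass` / `lexRow_card_top`. [this work] -/
theorem realisable_minor_lexRow_data (G : ℕ → Matrix (Fin 6) (Fin 6) ℝ) (hG : ∀ ν, Realisable (G ν)) {r : ℕ} (hr : 3 < r)
    (ρ γ : Fin r → Fin 6) (T : Finset (Equiv.Perm (Fin r))) :
    ∀ ν, ∑ σ : T, ((Equiv.Perm.sign (σ : Equiv.Perm (Fin r)) : ℤ) : ℝ) * ∏ a, G ν (ρ ((σ : Equiv.Perm (Fin r)) a)) (γ a) +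
      ∑ σ ∈ Tᶜ, ((Equiv.Perm.sign σ : ℤ) : ℝ) * ∏ a, G ν (ρ (σ a)) (γ a) = 0 :=
  fun ν => realisable_minor_row_split (hG ν) hr ρ γ T

/-! ## Composed minor rows (vanishing + LEMMA L of `…WallBubblingLexRows`) -/

open Filter Topology in
/-- **MINOR ROW, lexicographic top-class form (LEMMA L (iii) on a minor).**  A realisable sequence `G^ν`, a minor (`ρ, γ`, size `r ≥ 4`), a monomial class `T` with signed values
`x^ν_σ = sgn σ · ∏_a G^ν (ρ (σ a)) (γ a)` (`σ ∈ T`) not identically zero at any `ν` and DOMINATING the rest (`rest^ν/‖x^ν‖ → 0`) ⇒ along a subsequence two classes `σ ≠ τ` in `T` have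
opposite eventual signs and relative fine height `0` at every finer scale. [this work] -/
theorem realisable_minor_lexRow_topClass (G : ℕ → Matrix (Fin 6) (Fin 6) ℝ) (hG : ∀ ν, Realisable (G ν)) {r : ℕ} (hr : 3 < r)
    (ρ γ : Fin r → Fin 6) (T : Finset (Equiv.Perm (Fin r))) (x : ℕ → T → ℝ) (rest : ℕ → ℝ)
    (hxdef : ∀ ν (σ : T), x ν σ = ((Equiv.Perm.sign (σ : Equiv.Perm (Fin r)) : ℤ) : ℝ) * ∏ a, G ν (ρ ((σ : Equiv.Perm (Fin r)) a)) (γ a))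
    (hrdef : ∀ ν, rest ν = ∑ σ ∈ Tᶜ, ((Equiv.Perm.sign σ : ℤ) : ℝ) * ∏ a, G ν (ρ (σ a)) (γ a))
    (hx : ∀ ν, x ν ≠ 0) (hdom : Tendsto (fun ν => rest ν / ‖x ν‖) atTop (𝓝 0)) :
    ∃ φ : ℕ → ℕ, StrictMono φ ∧ ∃ σ τ : T, σ ≠ τ ∧
      (∀ᶠ k in atTop, 0 < x (φ k) σ) ∧ (∀ᶠ k in atTop, x (φ k) τ < 0) ∧
      ∀ w : ℕ → ℝ, Tendsto w atTop atTop →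
        Tendsto (fun k => (Real.log |x (φ k) σ| - Real.log ‖x (φ k)‖) / w k) atTop (𝓝 0) ∧
        Tendsto (fun k => (Real.log |x (φ k) τ| - Real.log ‖x (φ k)‖) / w k) atTop (𝓝 0) := by
  have hsum : ∀ ν, ∑ σ, x ν σ + rest ν = 0 := by
    intro ν
    rw [hrdef ν, Fintype.sum_congr _ _ (hxdef ν)]
    exact realisable_minor_row_split (hG ν) hr ρ γ T
  exact lexRow_topClass x rest hsum hx hdom

open Filter Topology in
/-- **MINOR ROW, one-scale form (LEMMA L (i) on a minor)**: under the same hypotheses the class `T` has at least two elements. [this work] -/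
theorem realisable_minor_lexRow_card (G : ℕ → Matrix (Fin 6) (Fin 6) ℝ) (hG : ∀ ν, Realisable (G ν)) {r : ℕ} (hr : 3 < r)
    (ρ γ : Fin r → Fin 6) (T : Finset (Equiv.Perm (Fin r))) (x : ℕ → T → ℝ) (rest : ℕ → ℝ)
    (hxdef : ∀ ν (σ : T), x ν σ = ((Equiv.Perm.sign (σ : Equiv.Perm (Fin r)) : ℤ) : ℝ) * ∏ a, G ν (ρ ((σ : Equiv.Perm (Fin r)) a)) (γ a))
    (hrdef : ∀ ν, rest ν = ∑ σ ∈ Tᶜ, ((Equiv.Perm.sign σ : ℤ) : ℝ) * ∏ a, G ν (ρ (σ a)) (γ a))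
    (hx : ∀ ν, x ν ≠ 0) (hdom : Tendsto (fun ν => rest ν / ‖x ν‖) atTop (𝓝 0)) : 1 < T.card := by
  have hsum : ∀ ν, ∑ σ, x ν σ + rest ν = 0 := by
    intro ν
    rw [hrdef ν, Fintype.sum_congr _ _ (hxdef ν)]
    exact realisable_minor_row_split (hG ν) hr ρ γ T
  have h := lexRow_card_top x rest hsum hx hdom
  rwa [Fintype.card_coe] at h

open Filter Topology in
/-- **MINOR ROW, two-class form (LEMMA L (ii) on a minor)**: `T = {σ₁, σ₂}`, `x = sgn σ₁·G^{σ₁}`, `y = sgn σ₂·G^{σ₂}`, the rest dominated by `max(|x|,|y|)` (positive eventually) ⇒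
opposite signs eventually, `|x|/|y| → 1` and `log|x| − log|y| → 0` along the WHOLE sequence. [this work] -/
theorem realisable_minor_lexRow_two (G : ℕ → Matrix (Fin 6) (Fin 6) ℝ) (hG : ∀ ν, Realisable (G ν)) {r : ℕ} (hr : 3 < r)
    (ρ γ : Fin r → Fin 6) (σ₁ σ₂ : Equiv.Perm (Fin r)) (hne : σ₁ ≠ σ₂) (x y rest : ℕ → ℝ)
    (hxdef : ∀ ν, x ν = ((Equiv.Perm.sign σ₁ : ℤ) : ℝ) * ∏ a, G ν (ρ (σ₁ a)) (γ a))
    (hydef : ∀ ν, y ν = ((Equiv.Perm.sign σ₂ : ℤ) : ℝ) * ∏ a, G ν (ρ (σ₂ a)) (γ a))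
    (hrdef : ∀ ν, rest ν = ∑ σ ∈ ({σ₁, σ₂} : Finset (Equiv.Perm (Fin r)))ᶜ, ((Equiv.Perm.sign σ : ℤ) : ℝ) * ∏ a, G ν (ρ (σ a)) (γ a))
    (hpos : ∀ᶠ ν in atTop, 0 < max |x ν| |y ν|) (hdom : Tendsto (fun ν => rest ν / max |x ν| |y ν|) atTop (𝓝 0)) :
    (∀ᶠ ν in atTop, x ν * y ν < 0) ∧ Tendsto (fun ν => |x ν| / |y ν|) atTop (𝓝 1) ∧
      Tendsto (fun ν => Real.log |x ν| - Real.log |y ν|) atTop (𝓝 0) := by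
  have hsum : ∀ ν, x ν + y ν + rest ν = 0 := by
    intro ν
    have h := realisable_minor_row (hG ν) hr ρ γ
    rw [← Finset.sum_add_sum_compl ({σ₁, σ₂} : Finset (Equiv.Perm (Fin r))), Finset.sum_pair hne] at h
    rw [hxdef, hydef, hrdef]
    exact h
  obtain ⟨h1, h2⟩ := lexRow_two x y rest hsum hpos hdom
  exact ⟨h1, h2, lexRow_two_log x y rest hsum hpos hdom⟩

end Summit.ValiantsHypothesis.ValiantsHypothesis.Theorems.LacunarySymmetroidMatrixDescartes.WallBubbling.SecondOrder
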